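import Summits.Ventures.CertifiedManyBodySolver.Rows.LiebBlockReflection

/-!
# Lieb's block inequality `E(W) ≥ ½ E(|W|) + ½ E(|Wᴴ|)` for a graded Lieb operator

Support file for the certified many-body solver (venture `CertifiedManyBodySolver`, lane A rows):
first certified bounds; not a superconductivity verdict; every number certified or labelled float.

Main result `re_hsInner_liebOp_ge_of_block`: for a graded Hermitian pair `(K, L)` and `U ≥ 0`, a
lower bound `q` on the quadratic form `M ↦ Re ⟨M, 𝓛 M⟩ / ‖M‖²` of
`𝓛 = liebOp K L (-U)` on the two SQUARE blocks (`a`-rows × `a`-columns and `b` × `b`) is a lower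
bound on the RECTANGULAR block `a × b`. This is the step of Lieb's proof of Theorem 2
(PRL 62 (1989) 1201, ineq. (6) with Theorem 1's uniqueness argument removed) in the
off-diagonal-block form of Tian (PRB 58 (1998) 7612, Step 3): the Hermitian dilation `X = M + Mᴴ`
has `E(X) = 2 E(M)` by the grading (`a ≠ b`), spin-reflection positivity gives `E(|X|) ≤ E(X)`
(`exists_abs_energy_le`), and `|X|` splits into its `a`- and `b`-blocks, each of norm `‖M‖`
(`abs_dilation_decomp`).

References: E. H. Lieb, Phys. Rev. Lett. **62** (1989) 1201; G.-S. Tian, Phys. Rev. B **58**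
(1998) 7612, Step 3.
-/

namespace Summit.Ventures.CertifiedManyBodySolver.Rows

open Matrix Finset Literature.MathematicalPhysics.QuantumLattice
open scoped ComplexOrder

section Block

variable {Λ : Type*} [DecidableEq Λ] [Fintype Λ] {X : Type*} [Fintype X]

/-- **Block structure of `|X|` for the dilation `X = M + Mᴴ`** of a matrix `M` supported on
`a`-particle rows and `b`-particle columns, `a ≠ b`: the positive square root `P` of
`X² = M Mᴴ + Mᴴ M` is `Π_a P Π_a + Π_b P Π_b`, and both blocks have Hilbert–Schmidt norm `‖M‖`
(`Tr Π_a P² = Tr M Mᴴ`, `Tr Π_b P² = Tr Mᴴ M`). Tian, PRB 58 (1998) 7612, Step 3, eqs. (Matrix),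
(WF2). [cite: Tian1998ChargeSpinGap, Step 3] -/
theorem abs_dilation_decomp {a b : ℕ} (hab : a ≠ b) {M P : Matrix (Finset Λ) (Finset Λ) ℂ}
    (hM : ∀ α β, M α β ≠ 0 → α.card = a ∧ β.card = b) (hP : P.PosSemidef)
    (hPX : P * P = (M + Mᴴ) * (M + Mᴴ)) {Qa Qb : Matrix (Finset Λ) (Finset Λ) ℂ}
    (hQa : Qa = diagonal fun α : Finset Λ => if α.card = a then (1 : ℂ) else 0)
    (hQb : Qb = diagonal fun α : Finset Λ => if α.card = b then (1 : ℂ) else 0) :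
    P = Qa * P * Qa + Qb * P * Qb ∧ hsInner (Qa * P * Qa) (Qa * P * Qa) = hsInner M M ∧
      hsInner (Qb * P * Qb) (Qb * P * Qb) = hsInner M M := by
  subst hQa hQb
  set Qa : Matrix (Finset Λ) (Finset Λ) ℂ :=
    (diagonal fun α : Finset Λ => if α.card = a then (1 : ℂ) else 0) with hQa
  set Qb : Matrix (Finset Λ) (Finset Λ) ℂ :=
    (diagonal fun α : Finset Λ => if α.card = b then (1 : ℂ) else 0) with hQb
  set X' := M + Mᴴ with hX
  have hMt := supp_conjTranspose hM
  have hMr : ∀ α β, M α β ≠ 0 → α.card = a := fun α β h => (hM α β h).1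
  have hMc : ∀ α β, M α β ≠ 0 → β.card = b := fun α β h => (hM α β h).2
  have hMtr : ∀ α β, Mᴴ α β ≠ 0 → α.card = b := fun α β h => (hMt α β h).1
  have hMtc : ∀ α β, Mᴴ α β ≠ 0 → β.card = a := fun α β h => (hMt α β h).2
  have haM : Qa * M = M := cardProj_mul_of_row hMr
  have hbM : Qb * M = 0 := cardProj_mul_eq_zero_of_row hab.symm hMr
  have haMt : Qa * Mᴴ = 0 := cardProj_mul_eq_zero_of_row hab hMtr
  have hbMt : Qb * Mᴴ = Mᴴ := cardProj_mul_of_row hMtr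
  have hMa : M * Qa = 0 := mul_cardProj_eq_zero_of_col hab hMc
  have hMb : M * Qb = M := mul_cardProj_of_col hMc
  have hMta : Mᴴ * Qa = Mᴴ := mul_cardProj_of_col hMtc
  have hMtb : Mᴴ * Qb = 0 := mul_cardProj_eq_zero_of_col hab.symm hMtc
  have hPaX : Qa * X' = M := by rw [hX, Matrix.mul_add, haM, haMt, add_zero]
  have hXPa : X' * Qa = Mᴴ := by rw [hX, Matrix.add_mul, hMa, hMta, zero_add]
  have hPbX : Qb * X' = Mᴴ := by rw [hX, Matrix.mul_add, hbM, hbMt, zero_add]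
  have hXPb : X' * Qb = M := by rw [hX, Matrix.add_mul, hMb, hMtb, add_zero]
  have hPh : Pᴴ = P := hP.1.eq
  -- `P` commutes with `Π_a` and `Π_b`
  have hQah : Qaᴴ = Qa := cardProj_conjTranspose a
  have hQbh : Qbᴴ = Qb := cardProj_conjTranspose b
  have hQaQa : Qa * Qa = Qa := cardProj_mul_cardProj a
  have hQbQb : Qb * Qb = Qb := cardProj_mul_cardProj b
  have hca : Qa * P = P * Qa :=
    proj_comm_of_sq_eq hQah hQaQa (by rw [hPaX, hXPa]) (by rw [hPaX, hMa]) hP hPX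
  have hcb : Qb * P = P * Qb :=
    proj_comm_of_sq_eq hQbh hQbQb (by rw [hPbX, hXPb, add_comm]) (by rw [hPbX, hMtb]) hP hPX
  -- the remainder `Pz P`, `Pz = 1 - Π_a - Π_b`, vanishes: `Tr (Pz P)(Pz P)ᴴ = Tr Pz X² Pz = 0`
  set Pz : Matrix (Finset Λ) (Finset Λ) ℂ := 1 - Qa - Qb with hPz
  have hPzX : Pz * X' = 0 := by
    rw [hPz, Matrix.sub_mul, Matrix.sub_mul, Matrix.one_mul, hPaX, hPbX, hX]
    abel
  have hR : Pz * P = 0 := by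
    rw [← hsInner_self_re_eq_zero_iff]
    have : hsInner (Pz * P) (Pz * P) = 0 := by
      rw [hsInner, trace_mul_comm, conjTranspose_mul, hPh,
        show Pz * P * (P * Pzᴴ) = (Pz * (P * P)) * Pzᴴ by simp only [Matrix.mul_assoc], hPX,
        ← Matrix.mul_assoc, hPzX, Matrix.zero_mul, Matrix.zero_mul, trace_zero]
    rw [this, Complex.zero_re]
  have hdec0 : P = Qa * P + Qb * P := by
    have h : Pz * P = P - Qa * P - Qb * P := by
      rw [hPz, Matrix.sub_mul, Matrix.sub_mul, Matrix.one_mul]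
    rw [h] at hR
    rw [← sub_eq_zero, ← hR]
    abel
  have haPa : Qa * P * Qa = Qa * P := by
    rw [Matrix.mul_assoc, ← hca, ← Matrix.mul_assoc, hQaQa]
  have hbPb : Qb * P * Qb = Qb * P := by
    rw [Matrix.mul_assoc, ← hcb, ← Matrix.mul_assoc, hQbQb]
  -- norms of the blocks
  have hMM : (M * M).trace = 0 := by
    have h := hsInner_eq_zero_of_row hab.symm hMtr hMr
    rwa [hsInner, conjTranspose_conjTranspose] at h
  have hMtMt : (Mᴴ * Mᴴ).trace = 0 := by
    have h := hsInner_eq_zero_of_row hab hMr hMtr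
    rwa [hsInner] at h
  have hnorm : ∀ Q : Matrix (Finset Λ) (Finset Λ) ℂ, Qᴴ = Q → Q * Q = Q →
      hsInner (Q * P) (Q * P) = (Q * X' * X').trace := by
    intro Q hQh hQQ
    rw [hsInner, conjTranspose_mul, hPh, hQh,
      show P * Q * (Q * P) = P * (Q * Q) * P by simp only [Matrix.mul_assoc], hQQ, trace_mul_cycle,
      hPX, trace_mul_comm, Matrix.mul_assoc]
  refine ⟨by rw [haPa, hbPb]; exact hdec0, ?_, ?_⟩
  · rw [haPa, hnorm Qa hQah hQaQa, hPaX, hX, Matrix.mul_add, trace_add, hMM, zero_add, hsInner,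
      trace_mul_comm]
  · rw [hbPb, hnorm Qb hQbh hQbQb, hPbX, hX, Matrix.mul_add, trace_add, hMtMt, add_zero, hsInner]

/-- **Spin-reflection positivity, one rectangular block from two square ones** (Lieb 1989 /
Tian 1998, abstract graded form). Let `𝓛 = liebOp K L (-U)` with `U ≥ 0`, `K` and every `Lₓ`
Hermitian and particle-number preserving on the spinless configurations `Finset Λ`. If the quadratic
form bound `q ‖Z‖² ≤ Re ⟨Z, 𝓛 Z⟩` holds for every `Z` supported on the square block `(a, a)` and for
every `Z` supported on `(b, b)`, then it holds for every `M` supported on the rectangular block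
`(a, b)`: with `X = M + Mᴴ` and `P = |X| = Π_a P Π_a + Π_b P Π_b` (`abs_dilation_decomp`),
`2 q ‖M‖² ≤ E(Π_a P Π_a) + E(Π_b P Π_b) = E(P) ≤ E(X) = 2 E(M)`. Lieb, PRL 62 (1989) 1201, proof of
Theorem 1; Tian, PRB 58 (1998) 7612, Step 3, (Bound1)–(Bound2).
[cite: LiebPRL1989, proof of Theorem 1] -/
theorem re_hsInner_liebOp_ge_of_block {K : Matrix (Finset Λ) (Finset Λ) ℂ}
    {L : X → Matrix (Finset Λ) (Finset Λ) ℂ} (hK : Kᴴ = K)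
    (hKg : ∀ α γ, K α γ ≠ 0 → α.card = γ.card) (hL : ∀ x, (L x)ᴴ = L x)
    (hLg : ∀ x α γ, L x α γ ≠ 0 → α.card = γ.card) {U : ℝ} (hU : 0 ≤ U) {q : ℝ} {a b : ℕ}
    (ha : ∀ Z : Matrix (Finset Λ) (Finset Λ) ℂ, (∀ α β, Z α β ≠ 0 → α.card = a ∧ β.card = a) →
      q * (hsInner Z Z).re ≤ (hsInner Z (liebOp K L (-U) Z)).re)
    (hb : ∀ Z : Matrix (Finset Λ) (Finset Λ) ℂ, (∀ α β, Z α β ≠ 0 → α.card = b ∧ β.card = b) →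
      q * (hsInner Z Z).re ≤ (hsInner Z (liebOp K L (-U) Z)).re)
    {M : Matrix (Finset Λ) (Finset Λ) ℂ} (hM : ∀ α β, M α β ≠ 0 → α.card = a ∧ β.card = b) :
    q * (hsInner M M).re ≤ (hsInner M (liebOp K L (-U) M)).re := by
  classical
  by_cases hab : a = b
  · subst hab
    exact ha M hM
  have hMr : ∀ α β, M α β ≠ 0 → α.card = a := fun α β h => (hM α β h).1
  have hMtr : ∀ α β, Mᴴ α β ≠ 0 → α.card = b := fun α β h => (supp_conjTranspose hM α β h).1
  -- the dilation `X = M + Mᴴ`, Lieb's `P = |X|` and its blocks `Π_a P Π_a`, `Π_b P Π_b`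
  have hXh : (M + Mᴴ).IsHermitian := by
    rw [IsHermitian, conjTranspose_add, conjTranspose_conjTranspose, add_comm]
  obtain ⟨P, hPpsd, hPP, hPle⟩ := exists_abs_energy_le (K := K) hL hU hXh
  obtain ⟨hPdec, hPa, hPb⟩ := abs_dilation_decomp hab hM hPpsd hPP rfl rfl
  set Qa : Matrix (Finset Λ) (Finset Λ) ℂ :=
    (diagonal fun α : Finset Λ => if α.card = a then (1 : ℂ) else 0) with hQa
  set Qb : Matrix (Finset Λ) (Finset Λ) ℂ :=
    (diagonal fun α : Finset Λ => if α.card = b then (1 : ℂ) else 0) with hQb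
  have hPasupp : ∀ α β : Finset Λ, (Qa * P * Qa) α β ≠ 0 → α.card = a ∧ β.card = a :=
    supp_cardProj_mul_mul_cardProj a a P
  have hPbsupp : ∀ α β : Finset Λ, (Qb * P * Qb) α β ≠ 0 → α.card = b ∧ β.card = b :=
    supp_cardProj_mul_mul_cardProj b b P
  -- (1), (2): the hypotheses in the square blocks
  have h1 := ha _ hPasupp
  have h2 := hb _ hPbsupp
  rw [hPa] at h1
  rw [hPb] at h2
  -- (3): `E(P) = E(Π_a P Π_a) + E(Π_b P Π_b)` (the blocks have rows of different grades)
  have h3 : hsInner P (liebOp K L (-U) P) =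
      hsInner (Qa * P * Qa) (liebOp K L (-U) (Qa * P * Qa)) +
        hsInner (Qb * P * Qb) (liebOp K L (-U) (Qb * P * Qb)) := by
    have hx1 : hsInner (Qa * P * Qa) (liebOp K L (-U) (Qb * P * Qb)) = 0 :=
      hsInner_eq_zero_of_row hab (fun α β h => (hPasupp α β h).1)
        (row_liebOp hKg hLg (-U) fun α β h => (hPbsupp α β h).1)
    have hx2 : hsInner (Qb * P * Qb) (liebOp K L (-U) (Qa * P * Qa)) = 0 :=
      hsInner_eq_zero_of_row (Ne.symm hab) (fun α β h => (hPbsupp α β h).1)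
        (row_liebOp hKg hLg (-U) fun α β h => (hPasupp α β h).1)
    conv_lhs => rw [hPdec]
    rw [liebOp_add, hsInner_add_left, hsInner_add_right, hsInner_add_right, hx1, hx2, add_zero,
      zero_add]
  -- (5): `E(X) = E(M) + E(Mᴴ) = 2 E(M)`
  have h5 : hsInner (M + Mᴴ) (liebOp K L (-U) (M + Mᴴ)) =
      hsInner M (liebOp K L (-U) M) + hsInner M (liebOp K L (-U) M) := by
    have hx1 : hsInner M (liebOp K L (-U) Mᴴ) = 0 :=
      hsInner_eq_zero_of_row hab hMr (row_liebOp hKg hLg (-U) hMtr)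
    have hx2 : hsInner Mᴴ (liebOp K L (-U) M) = 0 :=
      hsInner_eq_zero_of_row (Ne.symm hab) hMtr (row_liebOp hKg hLg (-U) hMr)
    rw [liebOp_add, hsInner_add_left, hsInner_add_right, hsInner_add_right, hx1, hx2, add_zero,
      zero_add, hsInner_liebOp_conjTranspose_self hK hL]
  -- (4): `E(P) ≤ E(X)`; combine
  have h4 := hPle
  rw [h3, h5, Complex.add_re, Complex.add_re] at h4
  linarith

end Block

end Summit.Ventures.CertifiedManyBodySolver.Rows
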